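import Literature.NumberTheory.QuadraticFields.IdealClassWeightedLatticeSum
import Literature.NumberTheory.QuadraticFields.IdealClassInverse
import HarnessLib

/-!
# Class sums depend only on the class, and a class and its inverse have the same class sums:
# `Σ_{𝔞 ∈ 𝒞} f(N𝔞) = Σ_{𝔞 ∈ 𝒞⁻¹} f(N𝔞)` (imaginary quadratic fields, `d_K < −4`)

Topic `NumberTheory/QuadraticFields`, namespace `Literature.NumberTheory.QuadraticFields.Quadratic`
(continuing `IdealClassWeightedLatticeSum.lean` and `IdealClassInverse.lean`). Everything here is
PROVED (theorems only, no definitions, no named facts).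

Class sums are written, as everywhere in this dictionary, over the ideals `𝔞` with `𝔠𝔞` principal
for a nonzero ideal `𝔠` — the integral ideals of the class `[𝔠]⁻¹` together with `𝔞 = 0`. We prove:

* `isPrincipal_mul_iff_of_mk0_eq` — the index set `{𝔞 : 𝔠𝔞 principal}` depends only on the class
  of `𝔠`; `hasSum_classSum_iff_of_mk0_eq` — hence so do the class sums (for any summand);
* `hasSum_classSum_of_mul_isPrincipal` — **a class and its inverse have the same class sums**: for
  an imaginary quadratic `K` with integral basis `(1, ω)`, `ω² = m + tω`, `d_K = t² + 4m < −4`,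
  nonzero `𝔠, 𝔠'` with `𝔠𝔠'` principal (`[𝔠'] = [𝔠]⁻¹`), and any weight `f : ℕ → ℂ` with
  `f 0 = 0` absolutely summable along every form of discriminant `d_K`:
  `HasSum_{𝔞 : 𝔠𝔞 principal} f(N𝔞) a → HasSum_{𝔞 : 𝔠'𝔞 principal} f(N𝔞) a`. Proof: `𝔠 = (g)(A, ω − k)`
  (`exists_eq_span_singleton_mul_span_pair`), the form `(A, 2k − t, C)` is primitive (fundamental
  discriminant, `isUnit_of_dvd_of_disc_eq`), the conjugate `(A, ω − (t − k))` represents the inverse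
  class (`mk0_formIdeal_neg_eq_inv`), and the two class sums are `½ Σ f(Ax² ∓ Bxy + Cy²)`
  (`hasSum_ideal_mul_isPrincipal_weight`), equal by `y ↦ −y`. Classically: `𝔞 ↦ 𝔞̄` is a
  norm-preserving bijection of `𝒞` onto `𝒞⁻¹` (Cox §7.B); in particular `θ_{𝒞⁻¹} = θ_𝒞` and
  `θ(z;ψ̄) = θ(z;ψ)` (Conrey–Iwaniec 2002, remark after (2.16)).

## References

* [Cox2013] D. A. Cox, *Primes of the form x² + ny²*, 2nd ed. (2013), §7.B Thm. 7.7.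
* [ConreyIwaniec2002] B. Conrey, H. Iwaniec, Acta Arith. 103 (2002) 259–312, §2 (2.16).
-/

noncomputable section

open Module NumberField Ideal
open scoped nonZeroDivisors

namespace Literature.NumberTheory.QuadraticFields.Quadratic

variable {K : Type*} [Field K] [NumberField K]

/-! ### The index set `{𝔞 : 𝔠𝔞 principal}` depends only on the class of `𝔠` -/

/-- For nonzero `𝔠, 𝔠'` in the same ideal class, `𝔠𝔞` is principal iff `𝔠'𝔞` is (both say
`[𝔞] = [𝔠]⁻¹`, or `𝔞 = 0`). [cite: Cox2013, §7.B Thm. 7.7] -/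
theorem isPrincipal_mul_iff_of_mk0_eq {𝔠 𝔠' : Ideal (𝓞 K)} (h𝔠 : 𝔠 ≠ ⊥) (h𝔠' : 𝔠' ≠ ⊥)
    (h : ClassGroup.mk0 ⟨𝔠, mem_nonZeroDivisors_of_ne_zero h𝔠⟩ =
      ClassGroup.mk0 ⟨𝔠', mem_nonZeroDivisors_of_ne_zero h𝔠'⟩) (J : Ideal (𝓞 K)) :
    (𝔠 * J).IsPrincipal ↔ (𝔠' * J).IsPrincipal := by
  by_cases hJ : J = ⊥
  · subst hJ
    simp only [Ideal.mul_bot]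
  · have hJ0 : J ∈ (Ideal (𝓞 K))⁰ := mem_nonZeroDivisors_of_ne_zero hJ
    have e : ∀ {𝔡 : Ideal (𝓞 K)} (h𝔡 : 𝔡 ≠ ⊥), (𝔡 * J).IsPrincipal ↔
        ClassGroup.mk0 ⟨𝔡, mem_nonZeroDivisors_of_ne_zero h𝔡⟩ * ClassGroup.mk0 ⟨J, hJ0⟩ = 1 := by
      intro 𝔡 h𝔡
      rw [← map_mul, ← ClassGroup.mk0_eq_one_iff (mem_nonZeroDivisors_of_ne_zero (mul_ne_zero h𝔡 hJ))]
      rfl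
    rw [e h𝔠, e h𝔠', h]

/-- **Class sums depend only on the class**: for nonzero `𝔠, 𝔠'` in the same class and any summand
`F`, `HasSum_{𝔞 : 𝔠𝔞 principal} F(𝔞) a ↔ HasSum_{𝔞 : 𝔠'𝔞 principal} F(𝔞) a`. [cite: Cox2013, §7.B Thm. 7.7] -/
theorem hasSum_classSum_iff_of_mk0_eq {𝔠 𝔠' : Ideal (𝓞 K)} (h𝔠 : 𝔠 ≠ ⊥) (h𝔠' : 𝔠' ≠ ⊥)
    (h : ClassGroup.mk0 ⟨𝔠, mem_nonZeroDivisors_of_ne_zero h𝔠⟩ =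
      ClassGroup.mk0 ⟨𝔠', mem_nonZeroDivisors_of_ne_zero h𝔠'⟩) (F : Ideal (𝓞 K) → ℂ) (a : ℂ) :
    HasSum (fun J : {J : Ideal (𝓞 K) // (𝔠 * J).IsPrincipal} => F J.1) a ↔
      HasSum (fun J : {J : Ideal (𝓞 K) // (𝔠' * J).IsPrincipal} => F J.1) a := by
  have hset : {J : Ideal (𝓞 K) | (𝔠 * J).IsPrincipal} = {J : Ideal (𝓞 K) | (𝔠' * J).IsPrincipal} :=
    Set.ext fun J => isPrincipal_mul_iff_of_mk0_eq h𝔠 h𝔠' h J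
  have key : ∀ {𝔡 𝔡' : Ideal (𝓞 K)},
      {J : Ideal (𝓞 K) | (𝔡 * J).IsPrincipal} = {J : Ideal (𝓞 K) | (𝔡' * J).IsPrincipal} →
      HasSum (fun J : {J : Ideal (𝓞 K) // (𝔡 * J).IsPrincipal} => F J.1) a →
        HasSum (fun J : {J : Ideal (𝓞 K) // (𝔡' * J).IsPrincipal} => F J.1) a := by
    intro 𝔡 𝔡' he hh
    have h1 : HasSum (Set.indicator {J : Ideal (𝓞 K) | (𝔡 * J).IsPrincipal} F) a :=
      (hasSum_subtype_iff_indicator (f := F) (s := {J : Ideal (𝓞 K) | (𝔡 * J).IsPrincipal})).mp hh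
    rw [he] at h1
    exact (hasSum_subtype_iff_indicator (f := F)
      (s := {J : Ideal (𝓞 K) | (𝔡' * J).IsPrincipal})).mpr h1
  exact ⟨key hset, key hset.symm⟩

/-! ### A class and its inverse have the same class sums -/

/-- The lattice sum of a weight is unchanged by `B ↦ −B` (`y ↦ −y`); private. [folklore] -/
private theorem tsum_weight_neg_snd (f : ℕ → ℂ) (A B C : ℤ) :
    (∑' p : ℤ × ℤ, f (A * p.1 ^ 2 + -B * p.1 * p.2 + C * p.2 ^ 2).natAbs) =
      ∑' p : ℤ × ℤ, f (A * p.1 ^ 2 + B * p.1 * p.2 + C * p.2 ^ 2).natAbs := by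
  rw [← (Equiv.prodCongr (Equiv.refl ℤ) (Equiv.neg ℤ)).tsum_eq
    (fun p : ℤ × ℤ => f (A * p.1 ^ 2 + B * p.1 * p.2 + C * p.2 ^ 2).natAbs)]
  refine tsum_congr fun p => ?_
  simp only [Equiv.prodCongr_apply, Equiv.coe_refl, Prod.map_fst, Prod.map_snd, id_eq,
    Equiv.neg_apply]
  congr 2
  ring

/-- **A class and its inverse have the same class sums** (imaginary quadratic field with integral
basis `(1, ω)`, `ω² = m + tω`, `d_K = t² + 4m < −4`): for nonzero `𝔠, 𝔠'` with `𝔠𝔠'` principal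
and a weight `f` (`f 0 = 0`) absolutely summable along every positive definite form of discriminant
`d_K`, `HasSum_{𝔞 : 𝔠𝔞 principal} f(N𝔞) a → HasSum_{𝔞 : 𝔠'𝔞 principal} f(N𝔞) a`. Proof:
`𝔠 = (g)(A, ω − k)` (`exists_eq_span_singleton_mul_span_pair`); the form `(A, 2k − t, C)` of
discriminant `d_K` is primitive (`isUnit_of_dvd_of_disc_eq`); `[(A, ω − (t − k))] = [(A, ω − k)]⁻¹ = [𝔠']`
(`mk0_formIdeal_neg_eq_inv`); both class sums equal `½ Σ f(Ax² ∓ (2k − t)xy + Cy²)`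
(`hasSum_ideal_mul_isPrincipal_weight`), the same number by `y ↦ −y`. This is "`𝔞 ↦ 𝔞̄` is a
norm-preserving bijection of `𝒞` onto `𝒞⁻¹`" (Cox §7.B), whence `θ(z;ψ̄) = θ(z;ψ)` for the
class-group theta series (Conrey–Iwaniec, after (2.16)).
[cite: Cox2013, §7.B Thm. 7.7] [cite: ConreyIwaniec2002, §2 (2.16)] -/
theorem hasSum_classSum_of_mul_isPrincipal (b : Basis (Fin 2) ℤ (𝓞 K)) (hb : b 0 = 1)
    {t m : ℤ} (hω : b 1 * b 1 = (m : 𝓞 K) + (t : 𝓞 K) * b 1) (hD : t ^ 2 + 4 * m < -4)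
    {𝔠 𝔠' : Ideal (𝓞 K)} (h𝔠 : 𝔠 ≠ ⊥) (h𝔠' : 𝔠' ≠ ⊥) (hcc : (𝔠 * 𝔠').IsPrincipal)
    {f : ℕ → ℂ} (hf0 : f 0 = 0)
    (hf : ∀ A B C : ℤ, 0 < A → B ^ 2 - 4 * A * C = t ^ 2 + 4 * m →
      Summable fun p : ℤ × ℤ => f (A * p.1 ^ 2 + B * p.1 * p.2 + C * p.2 ^ 2).natAbs)
    {a : ℂ} (h : HasSum (fun J : {J : Ideal (𝓞 K) // (𝔠 * J).IsPrincipal} => f (absNorm J.1)) a) :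
    HasSum (fun J : {J : Ideal (𝓞 K) // (𝔠' * J).IsPrincipal} => f (absNorm J.1)) a := by
  classical
  -- `𝔠 = (g)·(A, ω − k)`
  obtain ⟨g, A, k, C, hg, hA, hn, h𝔠eq⟩ := exists_eq_span_singleton_mul_span_pair b hb hω h𝔠
  set B : ℤ := 2 * k - t with hB
  have hdisc : B ^ 2 - 4 * A * C = t ^ 2 + 4 * m := by
    rw [hB]; linear_combination (-4 : ℤ) * hn
  have hprim : ∀ d : ℤ, d ∣ A → d ∣ B → d ∣ C → IsUnit d := fun d hdA hdB hdC =>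
    isUnit_of_dvd_of_disc_eq b hb hω hdisc hdA hdB hdC
  have hk : (B + t) / 2 = k := by rw [hB]; omega
  have hk' : (-B + t) / 2 = t - k := by rw [hB]; omega
  set 𝔟 : Ideal (𝓞 K) := span {(A : 𝓞 K), b 1 - k} with h𝔟
  set 𝔟' : Ideal (𝓞 K) := span {(A : 𝓞 K), b 1 - ((t - k : ℤ) : 𝓞 K)} with h𝔟'
  have hA0 : (A : 𝓞 K) ≠ 0 := fun h0 => hA.ne' (intCast_eq_zero_of_basis b hb h0)
  have h𝔟0 : 𝔟 ≠ ⊥ := fun h0 => hA0 (by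
    have hmem : (A : 𝓞 K) ∈ 𝔟 := Ideal.subset_span (by simp)
    rw [h0] at hmem; simpa using hmem)
  have h𝔟'0 : 𝔟' ≠ ⊥ := fun h0 => hA0 (by
    have hmem : (A : 𝓞 K) ∈ 𝔟' := Ideal.subset_span (by simp)
    rw [h0] at hmem; simpa using hmem)
  -- classes: `[𝔠] = [𝔟]`, `[𝔟'] = [𝔟]⁻¹`, `[𝔠'] = [𝔠]⁻¹`
  have hg0 : (g : 𝓞 K) ≠ 0 := fun h0 => hg.ne' (intCast_eq_zero_of_basis b hb h0)
  have h𝔠𝔟 : ClassGroup.mk0 ⟨𝔠, mem_nonZeroDivisors_of_ne_zero h𝔠⟩ =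
      ClassGroup.mk0 ⟨𝔟, mem_nonZeroDivisors_of_ne_zero h𝔟0⟩ := by
    rw [ClassGroup.mk0_eq_mk0_iff]
    exact ⟨1, (g : 𝓞 K), one_ne_zero, hg0, by
      rw [Ideal.span_singleton_one, Ideal.top_mul]; exact h𝔠eq⟩
  have h𝔟𝔟' : ClassGroup.mk0 ⟨𝔟', mem_nonZeroDivisors_of_ne_zero h𝔟'0⟩ =
      (ClassGroup.mk0 ⟨𝔟, mem_nonZeroDivisors_of_ne_zero h𝔟0⟩)⁻¹ := by
    have h1 := mk0_formIdeal_neg_eq_inv b hb hω hA.ne' hdisc hprim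
      (by rw [hk]; exact mem_nonZeroDivisors_of_ne_zero h𝔟0)
      (by rw [hk']; exact mem_nonZeroDivisors_of_ne_zero h𝔟'0)
    convert h1 using 3 <;> simp [h𝔟, h𝔟', hk, hk']
  have h𝔠𝔠' : ClassGroup.mk0 ⟨𝔠', mem_nonZeroDivisors_of_ne_zero h𝔠'⟩ =
      (ClassGroup.mk0 ⟨𝔠, mem_nonZeroDivisors_of_ne_zero h𝔠⟩)⁻¹ := by
    rw [ClassGroup.mk0_eq_mk0_inv_iff]
    obtain ⟨x, hx⟩ := hcc
    refine ⟨x, ?_, ?_⟩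
    · rintro rfl
      rw [Submodule.span_zero_singleton] at hx
      exact (mul_ne_zero h𝔠 h𝔠') hx
    · change 𝔠' * 𝔠 = span {x}
      rw [mul_comm]; exact hx
  have h𝔠'𝔟' : ClassGroup.mk0 ⟨𝔠', mem_nonZeroDivisors_of_ne_zero h𝔠'⟩ =
      ClassGroup.mk0 ⟨𝔟', mem_nonZeroDivisors_of_ne_zero h𝔟'0⟩ := by
    rw [h𝔠𝔠', h𝔟𝔟', h𝔠𝔟]
  -- the two explicit class sums
  have hval : HasSum (fun J : {J : Ideal (𝓞 K) // (𝔟 * J).IsPrincipal} => f (absNorm J.1))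
      (1 / 2 * ∑' p : ℤ × ℤ, f (A * p.1 ^ 2 + (t - 2 * k) * p.1 * p.2 + C * p.2 ^ 2).natAbs) :=
    hasSum_ideal_mul_isPrincipal_weight b hb hω hD hA hn hf0
      (hf A (t - 2 * k) C hA (by linear_combination (-4 : ℤ) * hn))
  have hn' : A * C = (t - k) ^ 2 - t * (t - k) - m := by rw [hn]; ring
  have hval' : HasSum (fun J : {J : Ideal (𝓞 K) // (𝔟' * J).IsPrincipal} => f (absNorm J.1))
      (1 / 2 * ∑' p : ℤ × ℤ, f (A * p.1 ^ 2 + (t - 2 * k) * p.1 * p.2 + C * p.2 ^ 2).natAbs) := by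
    have h2 := hasSum_ideal_mul_isPrincipal_weight b hb hω hD hA hn' hf0
      (hf A (t - 2 * (t - k)) C hA (by linear_combination (-4 : ℤ) * hn))
    have e : t - 2 * (t - k) = -(t - 2 * k) := by ring
    rw [e, tsum_weight_neg_snd] at h2
    exact h2
  -- transport `𝔠 → 𝔟 → 𝔟' → 𝔠'`
  have ha : a = 1 / 2 * ∑' p : ℤ × ℤ, f (A * p.1 ^ 2 + (t - 2 * k) * p.1 * p.2 + C * p.2 ^ 2).natAbs :=
    ((hasSum_classSum_iff_of_mk0_eq h𝔠 h𝔟0 h𝔠𝔟 (fun J => f (absNorm J)) a).mp h).unique hval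
  rw [ha]
  exact (hasSum_classSum_iff_of_mk0_eq h𝔠' h𝔟'0 h𝔠'𝔟' (fun J => f (absNorm J)) _).mpr hval'

end Literature.NumberTheory.QuadraticFields.Quadratic

end
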